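import Summits.CriticalPhenomena.CardyFormulaZ2.Theorems.CardyBoundaryCoulombGasBoundaryDefectGaussianRS17DictionaryOfPart3
import Summits.CriticalPhenomena.CardyFormulaZ2.Theorems.CardyBoundaryCoulombGasBoundaryDefectGaussianRS17HeightsExistPart5
import Summits.CriticalPhenomena.CardyFormulaZ2.Theorems.CardyBoundaryCoulombGasBoundaryDefectGaussianRS17StrandTurningPart6
import Summits.CriticalPhenomena.CardyFormulaZ2.Theorems.CardyBoundaryCoulombGasBoundaryDefectGaussianRS17ConfigsNonemptyPart14
import Summits.CriticalPhenomena.CardyFormulaZ2.Theorems.CardyBoundaryCoulombGasBoundaryDefectGaussianRS17RainbowOfConfig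
import Summits.CriticalPhenomena.CardyFormulaZ2.Theorems.CardyBoundaryCoulombGasBoundaryDefectGaussianRS17EventuallyRegular
import Summits.CriticalPhenomena.CardyFormulaZ2.Theorems.CardyBoundaryCoulombGasBoundaryDefectGaussianRS17NormZinsPos

/-!
# Stubs `stub_rainbowNonempty` and `stub_dictionaryPositivity` of line `rainbow-monomials-in-excursion-kernels`
# — the insertion dictionary D2, assembled (crux `BoundaryDefectGaussianR`, stmt-CriticalPhenomena-14132)

The D2 completion skeleton of the line (lead seats c2/c3, `Cruxes/BoundaryDefectGaussianR/Lines/rainbow_monomials_D2_skeleton.lean`)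
reduced the two realisability stubs of skeleton v5 to ten finite / eventual sub-goals `s17_*`, all of which are now theorems of the
tree (wave 1 of seat c3, 2026-08-16): `s17_eventually_configsNonempty` (…S17ConfigsNonemptyPart1–14: a capped multi-source distance
transform is a valid height configuration, eventually), `s17_heightsExist` (…S17HeightsExistPart1–5: every turning-rule-invariant arrow
assignment with the forced values at the cuts is realised by valid heights — divergence-free dart windings), `s17_strandTurning`
(…S17StrandTurningPart1–6: the turning number of a strand between two ends does not depend on the configuration — closed trails of the
oriented medial graph and the combinatorial Umlaufsatz with winding sign), `s17_dictionary_of` (…S17DictionaryOfPart1–3: the Baxter–Kelland–Wu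
count assembly), `s17_rainbow_of_config`, `s17_forcedBits`, `s17_eventually_regular`, `s17_uncutLoopTurning`, `s17_norm_Zins_pos_of_dictionary`.
This file is the GLUE:

* `s17_dictionary` — **the insertion dictionary** `‖Zins V ι‖ = #{ω ⊆ E : Rainbow ι V ω}` for an admissible leg insertion with flat insertion
  points on a lattice-connected, hole-free, locally charted `V` whose jump collar has a configuration;
* `s17_rainbowNonempty_of`, `s17_dictionaryPositivity_of` — the two eventual glue statements of the D2 skeleton;
* `stub_rainbowNonempty`, `stub_dictionaryPositivity` — the two registered stubs of skeleton v5, verbatim (hence `stub_realisability`).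

[BaxterKellandWu1976, §3–§4] for the strand expansion; everything is proved, no named fact is introduced.
-/

noncomputable section

open Filter Topology

namespace Summit.CriticalPhenomena.CardyFormulaZ2.Cruxes.BoundaryDefectGaussianR.RainbowMonomialsInExcursionKernels

open Literature.Probability.LatticeModels Literature.Probability.LatticeModels.CollarLegModel

/-- **The insertion dictionary D2** (registered sub-goal `s17_dictionary`): for an admissible leg insertion `ι` on `V` with insertion points
flat at radius `sinkLegs + 4`, boundary charts of radius `3`, `V` lattice-connected with king-connected complement and king charts of radius `6`,
and a jump collar admitting a height configuration, the modulus of the insertion partition function COUNTS the rainbow sets of live edges: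
`‖Zins V ι‖ = #{ω ⊆ E : Rainbow ι V ω}` — heights existence, strand-turning invariance and the count assembly. [cite: BaxterKellandWu1976, §3–§4] -/
theorem s17_dictionary : ∀ (ι : Literature.Probability.LatticeModels.CollarLegModel.LegInsertionData) (V : Finset (ℤ × ℤ)) [DecidablePred fun ω : Finset ((ℤ × ℤ) × Bool) => ι.Rainbow V ω], ι.IsAdmissible V → (∀ x ∈ insert ι.sink ι.source, ∃ dvec : ℤ × ℤ, (dvec = (1, 0) ∨ dvec = (-1, 0) ∨ dvec = (0, 1) ∨ dvec = (0, -1)) ∧ ∀ v : ℤ × ℤ, (v.1 - x.1) ^ 2 + (v.2 - x.2) ^ 2 ≤ ((ι.sinkLegs : ℤ) + 4) ^ 2 → (v ∈ V ↔ 0 ≤ (v.1 - x.1) * dvec.1 + (v.2 - x.2) * dvec.2)) → (∀ u ∈ V, ∀ k : Fin 4, u + Literature.Probability.LatticeModels.CollarLegModel.dir k ∉ V → ∃ (K : Fin 4) (c₁ c₂ : ℤ), (∀ v : ℤ × ℤ, |v.1 - u.1| ≤ 3 → |v.2 - u.2| ≤ 3 → (v ∈ V ↔ c₂ ≤ v.1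 * (Literature.Probability.LatticeModels.CollarLegModel.dir (K + 1)).1 + v.2 * (Literature.Probability.LatticeModels.CollarLegModel.dir (K + 1)).2)) ∨ (∀ v : ℤ × ℤ, |v.1 - u.1| ≤ 3 → |v.2 - u.2| ≤ 3 → (v ∈ V ↔ c₁ ≤ v.1 * (Literature.Probability.LatticeModels.CollarLegModel.dir K).1 + v.2 * (Literature.Probability.LatticeModels.CollarLegModel.dir K).2 ∧ c₂ ≤ v.1 * (Literature.Probability.LatticeModels.CollarLegModel.dir (K + 1)).1 + v.2 * (Literature.Probability.LatticeModels.CollarLegModel.dir (K + 1)).2)) ∨ (∀ v : ℤ × ℤ, |v.1 - u.1| ≤ 3 → |v.2 - u.2| ≤ 3 → (v ∈ V ↔ c₂ ≤ v.1 * (Literature.Probability.LatticeModels.CollarLegModel.dir (K + 1)).1 + v.2 * (Literature.Probability.LatticeModels.CollarLegModel.dir (K + 1)).2 ∨ v.1 * (Literature.Probability.LatticeModels.CollarLegModel.dir K).1 + v.2 * (Literature.Probability.LatticeModels.CollarLegModel.dir K).2 ≤ c₁))) → (∀ u ∈ V, ∀ w ∈ V, Relation.ReflTransGen (fun b c : ℤ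 × ℤ ↦ b ∈ V ∧ c ∈ V ∧ (b.1 - c.1) ^ 2 + (b.2 - c.2) ^ 2 = 1) u w) → (∀ u ∉ V, ∀ w ∉ V, Relation.ReflTransGen (fun b c : ℤ × ℤ ↦ b ∉ V ∧ c ∉ V ∧ max |b.1 - c.1| |b.2 - c.2| ≤ 1) u w) → (∀ z : ℤ × ℤ, z ∉ V → (∃ v ∈ V, max |v.1 - z.1| |v.2 - z.2| ≤ 1) → ∃ σ τ a c : ℤ, |σ| ≤ 1 ∧ |τ| ≤ 1 ∧ ((∀ v : ℤ × ℤ, max |v.1 - z.1| |v.2 - z.2| ≤ 6 → (v ∈ V ↔ 0 ≤ σ * (v.1 - a) ∧ 0 ≤ τ * (v.2 - c))) ∨ (∀ v : ℤ × ℤ, max |v.1 - z.1| |v.2 - z.2| ≤ 6 → (v ∈ V ↔ 0 < σ * (v.1 - a) ∨ 0 < τ * (v.2 - c))))) → ((ι.model V).configs).Nonempty → ‖Literature.Probability.LatticeModels.CollarLegModel.Zins V ι‖ = ((((ι.model V).E.powerset.filter (fun ω => ι.Rainbow V ω)).card : ℕ) : ℝ) :=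
  fun ι V _ hadm hflat hchart hconn hK hking => s17_dictionary_of ι V hadm hflat hchart hconn hK hking
    (s17_heightsExist ι V hadm hflat hchart hconn hK hking)
    (fun ω hω ω' hω' => s17_strandTurning ι V hadm hflat hchart hconn hK hking ω ω' hω hω')

/-- **Rainbow witness from a configuration** (registered sub-goal `s17_rainbowNonempty_of`): if, eventually along the mesh sequence, the jump
collar of every admissible flat separated datum has a height configuration, then eventually every such datum has a RAINBOW set of live edges —
the live edges with equal endpoint heights of that configuration (`s17_rainbow_of_config`, with the eventual regularity `s17_eventually_regular`). [folklore] -/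
theorem s17_rainbowNonempty_of : (∀ (k : ℕ) (L : Fin k → ℕ) (j : Fin k), L j = ∑ i ∈ Finset.univ.erase j, L i → ∀ (D : Literature.Probability.RandomPlanarGeometry.JordanDomain), (∃ S : Finset (ℂ × ℂ), (∀ q ∈ S, q.1.re = q.2.re ∨ q.1.im = q.2.im) ∧ frontier D.carrier ⊆ ⋃ q ∈ S, segment ℝ q.1 q.2) → ∀ (r : ℝ), 0 < r → ∀ (δ : ℕ → ℝ), (∀ n, 0 < δ n) → Filter.Tendsto δ Filter.atTop (nhds 0) → ∀ (V : ℕ → Finset (ℤ × ℤ)), (∀ n, ∀ v : ℤ × ℤ, v ∈ V n ↔ (((v).1 : ℂ) * ((δ n : ℝ) : ℂ) + ((v).2 : ℂ) * ((δ n : ℝ) : ℂ) * Complex.I) ∈ closure D.carrier) → ∀ᶠ n in Filter.atTop, ∀ (p : Fin k → ℤ × ℤ), Function.Injective p → Literature.Probability.LatticeModels.CollarLegModel.LegInsertionData.IsAdmissible (⟨(Finset.univ.erase j).image (p), fun v ↦ ∑ b ∈ (Finset.univ.erase j).filter (fun b ↦ (p) b = v), L b, (p) j⟩ : Literature.Probability.LatticeModels.CollarLegModel.LegInsertionData)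 (V n) → (∀ i', (∃ d : ℤ × ℤ, (d = (1, 0) ∨ d = (-1, 0) ∨ d = (0, 1) ∨ d = (0, -1)) ∧ ∀ v : ℤ × ℤ, (((((v).1 - (p i').1) ^ 2 + ((v).2 - (p i').2) ^ 2 : ℤ) : ℝ)) ≤ (r / δ n) ^ 2 → (v ∈ V n ↔ 0 ≤ (v.1 - (p i').1) * d.1 + (v.2 - (p i').2) * d.2))) → (∀ i₁ i₂ : Fin k, i₁ ≠ i₂ → (r / δ n) ^ 2 ≤ ((((((p) i₁).1 - ((p) i₂).1) ^ 2 + (((p) i₁).2 - ((p) i₂).2) ^ 2 : ℤ) : ℝ))) → ((Literature.Probability.LatticeModels.CollarLegModel.LegInsertionData.model (⟨(Finset.univ.erase j).image (p), fun v ↦ ∑ b ∈ (Finset.univ.erase j).filter (fun b ↦ (p) b = v), L b, (p) j⟩ : Literature.Probability.LatticeModels.CollarLegModel.LegInsertionData) (V n)).configs).Nonempty) → ∀ (k : ℕ) (L : Fin k → ℕ) (j : Fin k), L j = ∑ i ∈ Finset.univ.erase j, L i → ∀ (D : Literature.Probability.RandomPlanarGeometry.JordanDomain), (∃ S : Finset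 (ℂ × ℂ), (∀ q ∈ S, q.1.re = q.2.re ∨ q.1.im = q.2.im) ∧ frontier D.carrier ⊆ ⋃ q ∈ S, segment ℝ q.1 q.2) → ∀ (r : ℝ), 0 < r → ∀ (δ : ℕ → ℝ), (∀ n, 0 < δ n) → Filter.Tendsto δ Filter.atTop (nhds 0) → ∀ (V : ℕ → Finset (ℤ × ℤ)), (∀ n, ∀ v : ℤ × ℤ, v ∈ V n ↔ (((v).1 : ℂ) * ((δ n : ℝ) : ℂ) + ((v).2 : ℂ) * ((δ n : ℝ) : ℂ) * Complex.I) ∈ closure D.carrier) → ∀ᶠ n in Filter.atTop, ∀ (p : Fin k → ℤ × ℤ), Function.Injective p → Literature.Probability.LatticeModels.CollarLegModel.LegInsertionData.IsAdmissible (⟨(Finset.univ.erase j).image (p), fun v ↦ ∑ b ∈ (Finset.univ.erase j).filter (fun b ↦ (p) b = v), L b, (p) j⟩ : Literature.Probability.LatticeModels.CollarLegModel.LegInsertionData) (V n) → (∀ i', (∃ d : ℤ × ℤ, (d = (1, 0) ∨ d = (-1, 0) ∨ d = (0, 1) ∨ d = (0, -1)) ∧ ∀ v : ℤ × ℤ,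 (((((v).1 - (p i').1) ^ 2 + ((v).2 - (p i').2) ^ 2 : ℤ) : ℝ)) ≤ (r / δ n) ^ 2 → (v ∈ V n ↔ 0 ≤ (v.1 - (p i').1) * d.1 + (v.2 - (p i').2) * d.2))) → (∀ i₁ i₂ : Fin k, i₁ ≠ i₂ → (r / δ n) ^ 2 ≤ ((((((p) i₁).1 - ((p) i₂).1) ^ 2 + (((p) i₁).2 - ((p) i₂).2) ^ 2 : ℤ) : ℝ))) → (∃ ω : Finset ((ℤ × ℤ) × Bool), ω ⊆ Literature.Probability.LatticeModels.CollarLegModel.inducedEdges (V n) ∧ Literature.Probability.LatticeModels.CollarLegModel.LegInsertionData.Rainbow (⟨(Finset.univ.erase j).image (p), fun v ↦ ∑ b ∈ (Finset.univ.erase j).filter (fun b ↦ (p) b = v), L b, (p) j⟩ : Literature.Probability.LatticeModels.CollarLegModel.LegInsertionData) (V n) ω) := by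
  intro hP1 k L j hL D hD r hr δ hδ hδ0 V hV
  filter_upwards [hP1 k L j hL D hD r hr δ hδ hδ0 V hV, s17_eventually_regular k L j hL D hD r hr δ hδ hδ0 V hV] with n hne hreg
  intro p hp hadm hflat hsep
  obtain ⟨hFL4, hCH, -, -, -⟩ := hreg p hp hadm hflat hsep
  obtain ⟨h, hh⟩ := hne p hp hadm hflat hsep
  exact ⟨_, Finset.filter_subset _ _, s17_rainbow_of_config _ (V n) hadm hFL4 hCH h hh⟩

/-- **Dictionary positivity from the finite dictionary and eventual existence** (glue of the D2 skeleton): if the dictionary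
`‖Zins‖ = #Rainbow` holds for every admissible flat charted datum with a configuration, and configurations exist eventually, then eventually a
rainbow witness forces `0 < ‖Zins‖ / ‖Z‖` (numerator a positive count, denominator `2^{|E|}` by the closed-collar dictionary). [cite: BaxterKellandWu1976, §3–§4] -/
theorem s17_dictionaryPositivity_of : (∀ (ι : Literature.Probability.LatticeModels.CollarLegModel.LegInsertionData) (V : Finset (ℤ × ℤ)) [DecidablePred fun ω : Finset ((ℤ × ℤ) × Bool) => ι.Rainbow V ω], ι.IsAdmissible V → (∀ x ∈ insert ι.sink ι.source, ∃ dvec : ℤ × ℤ, (dvec = (1, 0) ∨ dvec = (-1, 0) ∨ dvec = (0, 1) ∨ dvec = (0, -1)) ∧ ∀ v : ℤ × ℤ, (v.1 - x.1) ^ 2 + (v.2 - x.2) ^ 2 ≤ ((ι.sinkLegs : ℤ) + 4) ^ 2 → (v ∈ V ↔ 0 ≤ (v.1 - x.1) * dvec.1 + (v.2 - x.2) * dvec.2)) → (∀ u ∈ V, ∀ k : Fin 4, u + Literature.Probability.LatticeModels.CollarLegModel.dir k ∉ V → ∃ (K : Fin 4) (c₁ c₂ : ℤ), (∀ v : ℤ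 × ℤ, |v.1 - u.1| ≤ 3 → |v.2 - u.2| ≤ 3 → (v ∈ V ↔ c₂ ≤ v.1 * (Literature.Probability.LatticeModels.CollarLegModel.dir (K + 1)).1 + v.2 * (Literature.Probability.LatticeModels.CollarLegModel.dir (K + 1)).2)) ∨ (∀ v : ℤ × ℤ, |v.1 - u.1| ≤ 3 → |v.2 - u.2| ≤ 3 → (v ∈ V ↔ c₁ ≤ v.1 * (Literature.Probability.LatticeModels.CollarLegModel.dir K).1 + v.2 * (Literature.Probability.LatticeModels.CollarLegModel.dir K).2 ∧ c₂ ≤ v.1 * (Literature.Probability.LatticeModels.CollarLegModel.dir (K + 1)).1 + v.2 * (Literature.Probability.LatticeModels.CollarLegModel.dir (K + 1)).2)) ∨ (∀ v : ℤ × ℤ, |v.1 - u.1| ≤ 3 → |v.2 - u.2| ≤ 3 → (v ∈ V ↔ c₂ ≤ v.1 * (Literature.Probability.LatticeModels.CollarLegModel.dir (K + 1)).1 + v.2 * (Literature.Probability.LatticeModels.CollarLegModel.dir (K + 1)).2 ∨ v.1 * (Literature.Probability.LatticeModels.CollarLegModel.dir K).1 + v.2 * (Literature.Probability.LatticeModels.CollarLegModel.dir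 K).2 ≤ c₁))) → (∀ u ∈ V, ∀ w ∈ V, Relation.ReflTransGen (fun b c : ℤ × ℤ ↦ b ∈ V ∧ c ∈ V ∧ (b.1 - c.1) ^ 2 + (b.2 - c.2) ^ 2 = 1) u w) → (∀ u ∉ V, ∀ w ∉ V, Relation.ReflTransGen (fun b c : ℤ × ℤ ↦ b ∉ V ∧ c ∉ V ∧ max |b.1 - c.1| |b.2 - c.2| ≤ 1) u w) → (∀ z : ℤ × ℤ, z ∉ V → (∃ v ∈ V, max |v.1 - z.1| |v.2 - z.2| ≤ 1) → ∃ σ τ a c : ℤ, |σ| ≤ 1 ∧ |τ| ≤ 1 ∧ ((∀ v : ℤ × ℤ, max |v.1 - z.1| |v.2 - z.2| ≤ 6 → (v ∈ V ↔ 0 ≤ σ * (v.1 - a) ∧ 0 ≤ τ * (v.2 - c))) ∨ (∀ v : ℤ × ℤ, max |v.1 - z.1| |v.2 - z.2| ≤ 6 → (v ∈ V ↔ 0 < σ * (v.1 - a) ∨ 0 < τ * (v.2 - c))))) → ((ι.model V).configs).Nonempty → ‖Literature.Probability.LatticeModels.CollarLegModel.Zins V ι‖ = ((((ι.model V).E.powerset.filter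 (fun ω => ι.Rainbow V ω)).card : ℕ) : ℝ)) → (∀ (k : ℕ) (L : Fin k → ℕ) (j : Fin k), L j = ∑ i ∈ Finset.univ.erase j, L i → ∀ (D : Literature.Probability.RandomPlanarGeometry.JordanDomain), (∃ S : Finset (ℂ × ℂ), (∀ q ∈ S, q.1.re = q.2.re ∨ q.1.im = q.2.im) ∧ frontier D.carrier ⊆ ⋃ q ∈ S, segment ℝ q.1 q.2) → ∀ (r : ℝ), 0 < r → ∀ (δ : ℕ → ℝ), (∀ n, 0 < δ n) → Filter.Tendsto δ Filter.atTop (nhds 0) → ∀ (V : ℕ → Finset (ℤ × ℤ)), (∀ n, ∀ v : ℤ × ℤ, v ∈ V n ↔ (((v).1 : ℂ) * ((δ n : ℝ) : ℂ) + ((v).2 : ℂ) * ((δ n : ℝ) : ℂ) * Complex.I) ∈ closure D.carrier) → ∀ᶠ n in Filter.atTop, ∀ (p : Fin k → ℤ × ℤ), Function.Injective p → Literature.Probability.LatticeModels.CollarLegModel.LegInsertionData.IsAdmissible (⟨(Finset.univ.erase j).image (p), fun v ↦ ∑ b ∈ (Finset.univ.erase j).filter (fun b ↦ (p) b = v), L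 b, (p) j⟩ : Literature.Probability.LatticeModels.CollarLegModel.LegInsertionData) (V n) → (∀ i', (∃ d : ℤ × ℤ, (d = (1, 0) ∨ d = (-1, 0) ∨ d = (0, 1) ∨ d = (0, -1)) ∧ ∀ v : ℤ × ℤ, (((((v).1 - (p i').1) ^ 2 + ((v).2 - (p i').2) ^ 2 : ℤ) : ℝ)) ≤ (r / δ n) ^ 2 → (v ∈ V n ↔ 0 ≤ (v.1 - (p i').1) * d.1 + (v.2 - (p i').2) * d.2))) → (∀ i₁ i₂ : Fin k, i₁ ≠ i₂ → (r / δ n) ^ 2 ≤ ((((((p) i₁).1 - ((p) i₂).1) ^ 2 + (((p) i₁).2 - ((p) i₂).2) ^ 2 : ℤ) : ℝ))) → ((Literature.Probability.LatticeModels.CollarLegModel.LegInsertionData.model (⟨(Finset.univ.erase j).image (p), fun v ↦ ∑ b ∈ (Finset.univ.erase j).filter (fun b ↦ (p) b = v), L b, (p) j⟩ : Literature.Probability.LatticeModels.CollarLegModel.LegInsertionData) (V n)).configs).Nonempty) → ∀ (k : ℕ) (L : Fin k → ℕ) (j : Fin k), L j = ∑ i ∈ Finset.univ.erase j, L i → ∀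 (D : Literature.Probability.RandomPlanarGeometry.JordanDomain), (∃ S : Finset (ℂ × ℂ), (∀ q ∈ S, q.1.re = q.2.re ∨ q.1.im = q.2.im) ∧ frontier D.carrier ⊆ ⋃ q ∈ S, segment ℝ q.1 q.2) → ∀ (r : ℝ), 0 < r → ∀ (δ : ℕ → ℝ), (∀ n, 0 < δ n) → Filter.Tendsto δ Filter.atTop (nhds 0) → ∀ (V : ℕ → Finset (ℤ × ℤ)), (∀ n, ∀ v : ℤ × ℤ, v ∈ V n ↔ (((v).1 : ℂ) * ((δ n : ℝ) : ℂ) + ((v).2 : ℂ) * ((δ n : ℝ) : ℂ) * Complex.I) ∈ closure D.carrier) → ∀ᶠ n in Filter.atTop, ∀ (p : Fin k → ℤ × ℤ), Function.Injective p → Literature.Probability.LatticeModels.CollarLegModel.LegInsertionData.IsAdmissible (⟨(Finset.univ.erase j).image (p), fun v ↦ ∑ b ∈ (Finset.univ.erase j).filter (fun b ↦ (p) b = v), L b, (p) j⟩ : Literature.Probability.LatticeModels.CollarLegModel.LegInsertionData) (V n) → (∀ i', (∃ d : ℤ × ℤ, (d = (1, 0) ∨ d = (-1, 0) ∨ d =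 (0, 1) ∨ d = (0, -1)) ∧ ∀ v : ℤ × ℤ, (((((v).1 - (p i').1) ^ 2 + ((v).2 - (p i').2) ^ 2 : ℤ) : ℝ)) ≤ (r / δ n) ^ 2 → (v ∈ V n ↔ 0 ≤ (v.1 - (p i').1) * d.1 + (v.2 - (p i').2) * d.2))) → (∀ i₁ i₂ : Fin k, i₁ ≠ i₂ → (r / δ n) ^ 2 ≤ ((((((p) i₁).1 - ((p) i₂).1) ^ 2 + (((p) i₁).2 - ((p) i₂).2) ^ 2 : ℤ) : ℝ))) → (∃ ω : Finset ((ℤ × ℤ) × Bool), ω ⊆ Literature.Probability.LatticeModels.CollarLegModel.inducedEdges (V n) ∧ Literature.Probability.LatticeModels.CollarLegModel.LegInsertionData.Rainbow (⟨(Finset.univ.erase j).image (p), fun v ↦ ∑ b ∈ (Finset.univ.erase j).filter (fun b ↦ (p) b = v), L b, (p) j⟩ : Literature.Probability.LatticeModels.CollarLegModel.LegInsertionData) (V n) ω) → 0 < (‖Literature.Probability.LatticeModels.CollarLegModel.Zins (V n) (⟨(Finset.univ.erase j).image (p), fun v ↦ ∑ b ∈ (Finset.univ.erase j).filter (fun b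 ↦ (p) b = v), L b, (p) j⟩ : Literature.Probability.LatticeModels.CollarLegModel.LegInsertionData)‖ / ‖(Literature.Probability.LatticeModels.CollarLegModel.ofDomain (V n)).Z‖) := by
  intro hDict hP1 k L j hL D hD r hr δ hδ hδ0 V hV
  filter_upwards [hP1 k L j hL D hD r hr δ hδ hδ0 V hV, s17_eventually_regular k L j hL D hD r hr δ hδ hδ0 V hV] with n hne hreg
  intro p hp hadm hflat hsep hex
  obtain ⟨hFL4, hCH, hconn, hK, hKC⟩ := hreg p hp hadm hflat hsep
  classical
  exact s17_norm_Zins_pos_of_dictionary _ (V n) hK (hDict _ (V n) hadm hFL4 hCH hconn hK hKC (hne p hp hadm hflat hsep)) hex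

/-- **Stub 3c₁ of skeleton v5 — a rainbow configuration exists, eventually** (registered stub `stub_rainbowNonempty` of crux
`BoundaryDefectGaussianR`, line `rainbow-monomials-in-excursion-kernels`): `s17_rainbowNonempty_of s17_eventually_configsNonempty`. [folklore] -/
theorem stub_rainbowNonempty : ∀ (k : ℕ) (L : Fin k → ℕ) (j : Fin k), L j = ∑ i ∈ Finset.univ.erase j, L i → ∀ (D : Literature.Probability.RandomPlanarGeometry.JordanDomain), (∃ S : Finset (ℂ × ℂ), (∀ q ∈ S, q.1.re = q.2.re ∨ q.1.im = q.2.im) ∧ frontier D.carrier ⊆ ⋃ q ∈ S, segment ℝ q.1 q.2) → ∀ (r : ℝ), 0 < r → ∀ (δ : ℕ → ℝ), (∀ n, 0 < δ n) → Filter.Tendsto δ Filter.atTop (nhds 0) → ∀ (V : ℕ → Finset (ℤ × ℤ)), (∀ n, ∀ v : ℤ × ℤ, v ∈ V n ↔ (((v).1 : ℂ) * ((δ n : ℝ) : ℂ) + ((v).2 : ℂ) * ((δ n : ℝ) : ℂ) * Complex.I) ∈ closure D.carrier) → ∀ᶠ n in Filter.atTop, ∀ (p : Fin k → ℤ × ℤ),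 Function.Injective p → Literature.Probability.LatticeModels.CollarLegModel.LegInsertionData.IsAdmissible (⟨(Finset.univ.erase j).image (p), fun v ↦ ∑ b ∈ (Finset.univ.erase j).filter (fun b ↦ (p) b = v), L b, (p) j⟩ : Literature.Probability.LatticeModels.CollarLegModel.LegInsertionData) (V n) → (∀ i', (∃ d : ℤ × ℤ, (d = (1, 0) ∨ d = (-1, 0) ∨ d = (0, 1) ∨ d = (0, -1)) ∧ ∀ v : ℤ × ℤ, (((((v).1 - (p i').1) ^ 2 + ((v).2 - (p i').2) ^ 2 : ℤ) : ℝ)) ≤ (r / δ n) ^ 2 → (v ∈ V n ↔ 0 ≤ (v.1 - (p i').1) * d.1 + (v.2 - (p i').2) * d.2))) → (∀ i₁ i₂ : Fin k, i₁ ≠ i₂ → (r / δ n) ^ 2 ≤ ((((((p) i₁).1 - ((p) i₂).1) ^ 2 + (((p) i₁).2 - ((p) i₂).2) ^ 2 : ℤ) : ℝ))) → (∃ ω : Finset ((ℤ × ℤ) × Bool), ω ⊆ Literature.Probability.LatticeModels.CollarLegModel.inducedEdges (V n) ∧ Literature.Probability.LatticeModels.CollarLegModel.LegInsertionData.Rainbow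 (⟨(Finset.univ.erase j).image (p), fun v ↦ ∑ b ∈ (Finset.univ.erase j).filter (fun b ↦ (p) b = v), L b, (p) j⟩ : Literature.Probability.LatticeModels.CollarLegModel.LegInsertionData) (V n) ω) :=
  s17_rainbowNonempty_of s17_eventually_configsNonempty

/-- **Stub 3c₂ of skeleton v5 — dictionary positivity, eventually** (registered stub `stub_dictionaryPositivity` of crux `BoundaryDefectGaussianR`,
line `rainbow-monomials-in-excursion-kernels`): the insertion dictionary `s17_dictionary` with the eventual existence of configurations. [cite: BaxterKellandWu1976, §3–§4] -/
theorem stub_dictionaryPositivity : ∀ (k : ℕ) (L : Fin k → ℕ) (j : Fin k), L j = ∑ i ∈ Finset.univ.erase j, L i → ∀ (D : Literature.Probability.RandomPlanarGeometry.JordanDomain), (∃ S : Finset (ℂ × ℂ), (∀ q ∈ S, q.1.re = q.2.re ∨ q.1.im = q.2.im) ∧ frontier D.carrier ⊆ ⋃ q ∈ S, segment ℝ q.1 q.2) → ∀ (r : ℝ), 0 < r → ∀ (δ : ℕ → ℝ), (∀ n, 0 < δ n) → Filter.Tendsto δ Filter.atTop (nhds 0) → ∀ (V : ℕ → Finset (ℤ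 × ℤ)), (∀ n, ∀ v : ℤ × ℤ, v ∈ V n ↔ (((v).1 : ℂ) * ((δ n : ℝ) : ℂ) + ((v).2 : ℂ) * ((δ n : ℝ) : ℂ) * Complex.I) ∈ closure D.carrier) → ∀ᶠ n in Filter.atTop, ∀ (p : Fin k → ℤ × ℤ), Function.Injective p → Literature.Probability.LatticeModels.CollarLegModel.LegInsertionData.IsAdmissible (⟨(Finset.univ.erase j).image (p), fun v ↦ ∑ b ∈ (Finset.univ.erase j).filter (fun b ↦ (p) b = v), L b, (p) j⟩ : Literature.Probability.LatticeModels.CollarLegModel.LegInsertionData) (V n) → (∀ i', (∃ d : ℤ × ℤ, (d = (1, 0) ∨ d = (-1, 0) ∨ d = (0, 1) ∨ d = (0, -1)) ∧ ∀ v : ℤ × ℤ, (((((v).1 - (p i').1) ^ 2 + ((v).2 - (p i').2) ^ 2 : ℤ) : ℝ)) ≤ (r / δ n) ^ 2 → (v ∈ V n ↔ 0 ≤ (v.1 - (p i').1) * d.1 + (v.2 - (p i').2) * d.2))) → (∀ i₁ i₂ : Fin k, i₁ ≠ i₂ → (r / δ n) ^ 2 ≤ ((((((p) i₁).1 - ((p)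 i₂).1) ^ 2 + (((p) i₁).2 - ((p) i₂).2) ^ 2 : ℤ) : ℝ))) → (∃ ω : Finset ((ℤ × ℤ) × Bool), ω ⊆ Literature.Probability.LatticeModels.CollarLegModel.inducedEdges (V n) ∧ Literature.Probability.LatticeModels.CollarLegModel.LegInsertionData.Rainbow (⟨(Finset.univ.erase j).image (p), fun v ↦ ∑ b ∈ (Finset.univ.erase j).filter (fun b ↦ (p) b = v), L b, (p) j⟩ : Literature.Probability.LatticeModels.CollarLegModel.LegInsertionData) (V n) ω) → 0 < (‖Literature.Probability.LatticeModels.CollarLegModel.Zins (V n) (⟨(Finset.univ.erase j).image (p), fun v ↦ ∑ b ∈ (Finset.univ.erase j).filter (fun b ↦ (p) b = v), L b, (p) j⟩ : Literature.Probability.LatticeModels.CollarLegModel.LegInsertionData)‖ / ‖(Literature.Probability.LatticeModels.CollarLegModel.ofDomain (V n)).Z‖) :=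
  s17_dictionaryPositivity_of (fun ι V _ => s17_dictionary ι V) s17_eventually_configsNonempty

end Summit.CriticalPhenomena.CardyFormulaZ2.Cruxes.BoundaryDefectGaussianR.RainbowMonomialsInExcursionKernels

end
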